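import Literature.Topology.FourManifolds.CyclicCoverMayerVietoris
import Literature.Topology.FourManifolds.AlexanderModuleCover
import HarnessLib

/-!
# The presentation of the Alexander module from a cut of the infinite cyclic cover

Topic `Literature/Topology/FourManifolds`; fourth module of the covering-space road to the Seifert
presentation of the Alexander module of a knot group, assembling

* `AlexanderModuleCover.lean` — `Φ : alexanderModule π₁(X, x₀) ≃+ H₁(X̃; ℤ)` with the group ring
  acting through the deck transformations (Rolfsen (1976) §7.A; Hatcher Thm. 2A.1), and
* `CyclicCoverMayerVietoris.lean` — for cut data `D : CutData f` (`X = Y ∪ N`), the copies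
  `genₖ : H₁(Y) → H₁(X̃)` generate, with the relations `genₖ (i₋ b) = genₖ₊₁ (i₊ b')` (`j₋ b = j₊ b'`)
  and nothing else (Rolfsen §8.C via Mayer–Vietoris),

into the algebraic statement consumed by the Fox–Milnor / Alexander-polynomial files
(`Knot.exists_eq_mul_invert_of_seifert_presentation`, `SliceKnotsFoxMilnorMetabolizer.lean`;
`exists_isAlexanderPolynomial_of_square_presentation`, `KnotGroupAbelianization.lean`):

* `CutData.exists_presentation_laurent` — given moreover a `ℤ`-basis `y` of `H₁(Y; ℤ)` (for a Seifert
  surface: Alexander duality), generators `c` of `H₁(N; ℤ)` realised on both sides of the cut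
  (`j₊ b⁺ₜ = cₜ = j₋ b⁻ₜ`) with `j±` injective and `j₊` onto (for a bicollar `N ≅ F × (-1, 1)`: all
  isomorphisms), and the integer matrices `A`, `B` of the two push-offs `i₊ b⁺ₜ = ∑ₗ Aₜₗ yₗ`,
  `i₋ b⁻ₜ = ∑ₗ Bₜₗ yₗ`, there is a `ℤ[Gᵃᵇ]`-linear surjection `ℤ[Gᵃᵇ]ⁿ → G'/G''`
  (`G = π₁(X, x₀)`) whose kernel is spanned by the rows of the `m × n` matrix **`B − t A`** over
  `ℤ[t, t⁻¹]`, pulled back along `laurentEquivOfMulEquiv G e'` for the isomorphism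
  `e' : Gᵃᵇ ≃* ℤ`, `e' [g] = (f_* g)⁻¹` (the inverse of the winding homomorphism: `t` then acts as
  the deck transformation `+1`). For a knot and a Seifert surface of genus `g` (`m = n = 2g`,
  `B = V`, `A = Vᵀ` in the linking-dual basis) this is the presentation matrix `V − tVᵀ`
  (Rolfsen (1976), §8.C; Lickorish (1997), Thm. 6.5).

Everything is proved; no named fact is introduced; the only new definitions are the generators
`genClass` and the rows `relRow` of the presentation.

## References

* D. Rolfsen, *Knots and Links*, Publish or Perish (1976), §8.C. [Rolfsen1976]
* W. B. R. Lickorish, *An Introduction to Knot Theory*, GTM 175 (1997), Thm. 6.5. [Lickorish1997]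
* R. H. Crowell, R. H. Fox, *Introduction to Knot Theory* (1963), Ch. VIII §3. [CrowellFox1963]
-/

noncomputable section

-- as in the tree's singular-homology files (`SingularChainsConcrete.lean`, `ClopenAdditivity.lean`):
-- unification through the `ModuleCat`/biproduct API needs the permissive transparency setting
set_option backward.isDefEq.respectTransparency false

open Set Function Multiplicative
open scoped LaurentPolynomial
open Literature.AlgebraicTopology.SingularHomology

universe u

namespace Literature.Topology.FourManifolds

namespace CircleMaps

namespace CyclicCover

namespace CutData

variable {X : Type u} [TopologicalSpace X] [PathConnectedSpace X] {f : C(X, Circle)} {x₀ : X}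
  {γ₀ : Path x₀ x₀} {h₀ : winding f γ₀ = 1}
  {hker : (windingHom f x₀).ker = commutator (FundamentalGroup X x₀)}
  (e' : Abelianization (FundamentalGroup X x₀) ≃* Multiplicative ℤ)
  (he' : ∀ g, e' (Abelianization.of g) = (windingHom f x₀ g)⁻¹)
  (D : CutData f)

/-- Local notation: the group ring `ℤ[Gᵃᵇ]` of `G = π₁(X, x₀)`. -/
local notation "Λ" => MonoidAlgebra ℤ (Abelianization (FundamentalGroup X x₀))

/-! ### The group ring acts through the deck transformations -/

omit [PathConnectedSpace X] in
/-- The deck transformation on `H₁(X̃)` written with `deck`. [folklore] -/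
theorem deck_gen' (m k : ℤ) (a : singularHomology ℤ ℤ ↥D.Y 1) :
    singularHomology.map ℤ ℤ (deck f m) 1 (D.gen ℤ ℤ k 1 a) = D.gen ℤ ℤ (k + m) 1 a :=
  D.deck_gen ℤ ℤ m k 1 a

include he' in
/-- `Φ (r·a • m) = r · τ_{e' a} (Φ m)`: under the isomorphism of `AlexanderModuleCover.lean` the
group-ring generator `r·a` acts as `r` times the deck transformation by `e' a` (with
`e' [g] = (f_* g)⁻¹`; `alexanderModuleEquiv_single_smul`). [folklore] -/
theorem equiv_single_smul (a : Abelianization (FundamentalGroup X x₀)) (r : ℤ)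
    (m : alexanderModule (FundamentalGroup X x₀)) :
    alexanderModuleEquiv h₀ hker (MonoidAlgebra.single a r • m) =
      r • singularHomology.map ℤ ℤ (deck f (toAdd (e' a))) 1 (alexanderModuleEquiv h₀ hker m) := by
  induction a using QuotientGroup.induction_on with | H g => ?_
  have h1 := alexanderModuleEquiv_single_smul (h₀ := h₀) (hker := hker) g r m
  have h2 : toAdd (e' (Abelianization.of g)) = -toAdd (windingHom f x₀ g) := by rw [he', toAdd_inv]
  rw [← h2] at h1
  exact h1

/-! ### Generators and relation rows -/

variable {D} in
/-- **The generators**: the classes `gⱼ = Φ⁻¹ (gen₀ yⱼ) ∈ G'/G''` of a family `y` of classes of the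
cut-open piece `Y`, placed in the `0`-th copy (Rolfsen 1976, §8.C: "generators of `H₁(Y₀)`").
[cite: Rolfsen1976, §8.C] -/
def genClass (h₀ : winding f γ₀ = 1) (hker : (windingHom f x₀).ker = commutator (FundamentalGroup X x₀))
    (D : CutData f) {n : ℕ} (y : Fin n → singularHomology ℤ ℤ ↥D.Y 1) (j : Fin n) :
    alexanderModule (FundamentalGroup X x₀) :=
  (alexanderModuleEquiv h₀ hker).symm (D.gen ℤ ℤ 0 1 (y j))

/-- `Φ gⱼ = gen₀ yⱼ`. [folklore] -/
@[simp] theorem equiv_genClass {n : ℕ} (y : Fin n → singularHomology ℤ ℤ ↥D.Y 1) (j : Fin n) :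
    alexanderModuleEquiv h₀ hker (genClass h₀ hker D y j) = D.gen ℤ ℤ 0 1 (y j) :=
  AddEquiv.apply_symm_apply _ _

include he' in
/-- `Φ (r·a • gⱼ) = r · gen_{e' a} yⱼ`. [folklore] -/
theorem equiv_single_smul_genClass {n : ℕ} (y : Fin n → singularHomology ℤ ℤ ↥D.Y 1) (j : Fin n)
    (a : Abelianization (FundamentalGroup X x₀)) (r : ℤ) :
    alexanderModuleEquiv h₀ hker (MonoidAlgebra.single a r • genClass h₀ hker D y j) =
      r • D.gen ℤ ℤ (toAdd (e' a)) 1 (y j) := by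
  rw [equiv_single_smul e' he', equiv_genClass, deck_gen', zero_add]

include he' in
/-- `Φ (r·e'⁻¹(k) • gⱼ) = r · genₖ yⱼ`. [folklore] -/
theorem equiv_single_symm_smul_genClass {n : ℕ} (y : Fin n → singularHomology ℤ ℤ ↥D.Y 1) (j : Fin n)
    (k : ℤ) (r : ℤ) :
    alexanderModuleEquiv h₀ hker (MonoidAlgebra.single (e'.symm (ofAdd k)) r • genClass h₀ hker D y j) =
      r • D.gen ℤ ℤ k 1 (y j) := by
  rw [D.equiv_single_smul_genClass e' he', MulEquiv.apply_symm_apply, toAdd_ofAdd]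

/-- **The relation rows** `(1·Bₜₗ − e'⁻¹(1)·Aₜₗ)ₗ ∈ ℤ[Gᵃᵇ]ⁿ` (the row `Bₜ − t Aₜ` of `B − tA`, read in
the group ring through `e'`). [cite: Rolfsen1976, §8.C] -/
def relRow {n m : ℕ} (A B : Matrix (Fin m) (Fin n) ℤ) (t : Fin m) (l : Fin n) : Λ :=
  MonoidAlgebra.single 1 (B t l) - MonoidAlgebra.single (e'.symm (ofAdd 1)) (A t l)

/-! ### Integer combinations of a family of classes -/

section Comb

variable {n : ℕ}

omit [PathConnectedSpace X] in
variable {D} in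
/-- **Integer combinations** `u ↦ ∑ₗ uₗ • yₗ` of a family `y` of classes of `Y`, as an additive map
`ℤⁿ →+ H₁(Y; ℤ)` (integer multiples are the `ℤ`-action of the additive group, Mathlib
`zmultiplesHom`). [folklore] -/
def comb (y : Fin n → singularHomology ℤ ℤ ↥D.Y 1) : (Fin n → ℤ) →+ singularHomology ℤ ℤ ↥D.Y 1 :=
  ∑ l, (zmultiplesHom _ (y l)).comp (Pi.evalAddMonoidHom (fun _ : Fin n => ℤ) l)

omit [PathConnectedSpace X] in
/-- `comb y u = ∑ₗ uₗ • yₗ`. [folklore] -/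
theorem comb_apply (y : Fin n → singularHomology ℤ ℤ ↥D.Y 1) (u : Fin n → ℤ) :
    comb y u = ∑ l, u l • y l := by
  rw [comb, AddMonoidHom.finsetSum_apply]
  rfl

end Comb

/-! ### The dictionary between `ℤ[Gᵃᵇ]`-combinations and families over the copies -/

section Dictionary

variable {n : ℕ} (y : Fin n → singularHomology ℤ ℤ ↥D.Y 1)

/-- The coefficients at the copy `k` of `ρ ∈ ℤ[Gᵃᵇ]ⁿ`: `l ↦ ρₗ (e'⁻¹ k)`. [folklore] -/
def coeffAt (ρ : Fin n → Λ) (k : ℤ) (l : Fin n) : ℤ := (ρ l).coeff (e'.symm (ofAdd k))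

/-- The family over the copies attached to `ρ ∈ ℤ[Gᵃᵇ]ⁿ`: `k ↦ ∑ₗ ρₗ(e'⁻¹ k) • yₗ`. [folklore] -/
def fam (ρ : Fin n → Λ) (k : ℤ) : singularHomology ℤ ℤ ↥D.Y 1 := comb y (coeffAt e' ρ k)

/-- A finite set of copies outside of which the family of `ρ` vanishes. [folklore] -/
def famSupport (ρ : Fin n → Λ) : Finset ℤ :=
  Finset.univ.biUnion fun l => (ρ l).coeff.support.image fun a => toAdd (e' a)

variable {e'} in
omit [PathConnectedSpace X] in
/-- Off `famSupport ρ` all the coefficients `ρₗ (e'⁻¹ k)` vanish. [folklore] -/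
theorem coeffAt_eq_zero {ρ : Fin n → Λ} {k : ℤ} (hk : k ∉ famSupport e' ρ) : coeffAt e' ρ k = 0 := by
  classical
  funext l
  by_contra h
  apply hk
  rw [famSupport, Finset.mem_biUnion]
  refine ⟨l, Finset.mem_univ l, Finset.mem_image.2 ⟨e'.symm (ofAdd k), Finsupp.mem_support_iff.2 h, ?_⟩⟩
  rw [MulEquiv.apply_symm_apply, toAdd_ofAdd]

variable {e'} in
omit [PathConnectedSpace X] in
/-- Off `famSupport ρ` the family vanishes. [folklore] -/
theorem fam_eq_zero {ρ : Fin n → Λ} {k : ℤ} (hk : k ∉ famSupport e' ρ) : fam e' D y ρ k = 0 := by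
  rw [fam, coeffAt_eq_zero hk, map_zero]

include he' in
/-- `Φ (ρₗ • gₗ) = ∑_{k ∈ S} ρₗ(e'⁻¹ k) · genₖ yₗ` for `S ⊇ famSupport ρ`. [folklore] -/
theorem equiv_smul_genClass (ρ : Fin n → Λ) {S : Finset ℤ} (hS : famSupport e' ρ ⊆ S) (l : Fin n) :
    alexanderModuleEquiv h₀ hker (ρ l • genClass h₀ hker D y l) =
      ∑ k ∈ S, ((ρ l).coeff (e'.symm (ofAdd k))) • D.gen ℤ ℤ k 1 (y l) := by
  classical
  conv_lhs => rw [← MonoidAlgebra.sum_coeff_single (ρ l), Finsupp.sum, Finset.sum_smul, map_sum]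
  simp only [D.equiv_single_smul_genClass e' he']
  -- reindex `a ↦ k = e' a`
  have hinj : Set.InjOn (fun a : Abelianization (FundamentalGroup X x₀) => toAdd (e' a)) (ρ l).coeff.support :=
    fun a _ b _ hab => e'.injective (toAdd.injective hab)
  have hsub : (ρ l).coeff.support.image (fun a => toAdd (e' a)) ⊆ S := fun k hk =>
    hS (Finset.mem_biUnion.2 ⟨l, Finset.mem_univ l, hk⟩)
  rw [← Finset.sum_subset hsub, Finset.sum_image hinj]
  · refine Finset.sum_congr rfl fun a _ => ?_
    simp only [ofAdd_toAdd, MulEquiv.symm_apply_apply]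
  · intro k _ hk
    have : (ρ l).coeff (e'.symm (ofAdd k)) = 0 := by
      by_contra h
      exact hk (Finset.mem_image.2 ⟨e'.symm (ofAdd k), Finsupp.mem_support_iff.2 h, by simp⟩)
    rw [this, zero_smul]

include he' in
/-- **The dictionary**: `Φ (∑ₗ ρₗ • gₗ) = ∑ₖ genₖ (∑ₗ ρₗ(e'⁻¹ k) • yₗ)`, the sum over any finite set of
copies containing `famSupport ρ`. [folklore] -/
theorem equiv_sum_smul_genClass (ρ : Fin n → Λ) {S : Finset ℤ} (hS : famSupport e' ρ ⊆ S) :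
    alexanderModuleEquiv h₀ hker (∑ l, ρ l • genClass h₀ hker D y l) =
      ∑ k ∈ S, D.gen ℤ ℤ k 1 (fam e' D y ρ k) := by
  rw [map_sum]
  simp only [D.equiv_smul_genClass e' he' y ρ hS]
  rw [Finset.sum_comm]
  refine Finset.sum_congr rfl fun k _ => ?_
  rw [fam, comb_apply, map_sum]
  refine Finset.sum_congr rfl fun l _ => ?_
  rw [map_zsmul]
  rfl

end Dictionary

/-! ### Generation, relations, completeness -/

section Presentation

variable {n m : ℕ} (y : Fin n → singularHomology ℤ ℤ ↥D.Y 1)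
  (c : Fin m → singularHomology ℤ ℤ ↥D.N 1)
  (bp : Fin m → singularHomology ℤ ℤ ↥D.plus 1) (bm : Fin m → singularHomology ℤ ℤ ↥D.minus 1)
  (A B : Matrix (Fin m) (Fin n) ℤ)

include he' in
/-- **Generation** (Rolfsen 1976, §8.C: `H₁(X̃)` is generated over `Λ` by generators of `H₁(Y₀)`):
under the hypotheses of `CutData.exists_eq_sum_gen`, if `y` spans `H₁(Y; ℤ)` the classes `gⱼ`
generate `G'/G''` over `ℤ[Gᵃᵇ]`. [cite: Rolfsen1976, §8.C] -/
theorem span_genClass_eq_top (hεp : Injective (singularHomology.ε ℤ ℤ ↥D.plus))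
    (hεm : Injective (singularHomology.ε ℤ ℤ ↥D.minus)) (hjs : Surjective (D.jPlus ℤ ℤ 1))
    (hspan : ∀ x : singularHomology ℤ ℤ ↥D.Y 1, ∃ u : Fin n → ℤ, x = comb y u) :
    Submodule.span Λ (Set.range (genClass h₀ hker D y)) = ⊤ := by
  classical
  rw [eq_top_iff]
  rintro x -
  obtain ⟨S, a, -, hx⟩ := D.exists_eq_sum_gen ℤ ℤ hεp hεm hjs (alexanderModuleEquiv h₀ hker x)
  choose u hu using fun k => hspan (a k)
  -- `ρₗ = ∑ₖ (coordinate of aₖ at yₗ) · e'⁻¹ k`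
  set ρ : Fin n → Λ := fun l => ∑ k ∈ S, MonoidAlgebra.single (e'.symm (ofAdd k)) (u k l) with hρ
  have key : alexanderModuleEquiv h₀ hker (∑ l, ρ l • genClass h₀ hker D y l) =
      alexanderModuleEquiv h₀ hker x := by
    rw [hx, map_sum]
    simp only [hρ, Finset.sum_smul, map_sum, D.equiv_single_symm_smul_genClass e' he']
    rw [Finset.sum_comm]
    refine Finset.sum_congr rfl fun k _ => ?_
    rw [hu k, comb_apply, map_sum]
    refine Finset.sum_congr rfl fun l _ => ?_
    rw [map_zsmul]
  rw [← (alexanderModuleEquiv h₀ hker).injective key]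
  exact Submodule.sum_mem _ fun l _ => Submodule.smul_mem _ _ (Submodule.subset_span ⟨l, rfl⟩)

include he' in
/-- **The relations hold** (Rolfsen 1976, §8.C: the relations `t aᵢ⁺ = aᵢ⁻`): if `j₊ b⁺ₜ = cₜ = j₋ b⁻ₜ`,
`i₊ b⁺ₜ = ∑ₗ Aₜₗ yₗ`, `i₋ b⁻ₜ = ∑ₗ Bₜₗ yₗ`, then `∑ₗ (Bₜₗ − e'⁻¹(1) Aₜₗ) • gₗ = 0`. [cite: Rolfsen1976, §8.C] -/
theorem sum_relRow_smul_genClass (hbp : ∀ t, D.jPlus ℤ ℤ 1 (bp t) = c t)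
    (hbm : ∀ t, D.jMinus ℤ ℤ 1 (bm t) = c t) (hA : ∀ t, D.iPlus ℤ ℤ 1 (bp t) = comb y (A t))
    (hB : ∀ t, D.iMinus ℤ ℤ 1 (bm t) = comb y (B t)) (t : Fin m) :
    ∑ l, relRow e' A B t l • genClass h₀ hker D y l = 0 := by
  apply (alexanderModuleEquiv h₀ hker).injective
  rw [map_zero, map_sum]
  have h1 : ∀ l, alexanderModuleEquiv h₀ hker (relRow e' A B t l • genClass h₀ hker D y l) =
      B t l • D.gen ℤ ℤ 0 1 (y l) - A t l • D.gen ℤ ℤ 1 1 (y l) := fun l => by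
    rw [relRow, sub_smul, map_sub, D.equiv_single_smul_genClass e' he', map_one, toAdd_one,
      D.equiv_single_symm_smul_genClass e' he']
  simp only [h1, Finset.sum_sub_distrib]
  rw [sub_eq_zero]
  have hrel := D.gen_rel ℤ ℤ 0 1 ((hbm t).trans (hbp t).symm)
  rw [zero_add, hB, hA, comb_apply, comb_apply, map_sum, map_sum] at hrel
  simpa only [map_zsmul] using hrel

omit [PathConnectedSpace X] in
/-- Coefficients of a product of two `single`s of the group ring at `e'⁻¹ k`. [folklore] -/
theorem coeff_single_symm_mul_single_symm (k' j k : ℤ) (r s : ℤ) :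
    (MonoidAlgebra.single (e'.symm (ofAdd k')) r * MonoidAlgebra.single (e'.symm (ofAdd j)) s).coeff
        (e'.symm (ofAdd k)) = if k' + j = k then r * s else 0 := by
  classical
  rw [MonoidAlgebra.single_mul_single, ← map_mul, ← ofAdd_add, MonoidAlgebra.coeff_single,
    Finsupp.single_apply]
  simp only [EmbeddingLike.apply_eq_iff_eq]

include he' in
/-- **Completeness of the relations** (Rolfsen 1976, §8.C): if `y` is `ℤ`-independent, `c` spans
`H₁(N; ℤ)`, `j₊`, `j₋` are injective and `∑ₗ ρₗ • gₗ = 0`, then `ρ` is a `ℤ[Gᵃᵇ]`-combination of the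
relation rows. [cite: Rolfsen1976, §8.C] -/
theorem mem_span_relRow_of_sum_smul_eq_zero (hind : ∀ u : Fin n → ℤ, comb y u = 0 → u = 0)
    (hc : ∀ x : singularHomology ℤ ℤ ↥D.N 1, ∃ β : Fin m → ℤ, x = ∑ t, β t • c t)
    (hjpi : Injective (D.jPlus ℤ ℤ 1)) (hjmi : Injective (D.jMinus ℤ ℤ 1))
    (hbp : ∀ t, D.jPlus ℤ ℤ 1 (bp t) = c t) (hbm : ∀ t, D.jMinus ℤ ℤ 1 (bm t) = c t)
    (hA : ∀ t, D.iPlus ℤ ℤ 1 (bp t) = comb y (A t)) (hB : ∀ t, D.iMinus ℤ ℤ 1 (bm t) = comb y (B t))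
    (ρ : Fin n → Λ) (hρ : ∑ l, ρ l • genClass h₀ hker D y l = 0) :
    ρ ∈ Submodule.span Λ (Set.range (relRow e' A B)) := by
  classical
  -- the family of `ρ` sums to zero over the copies
  have hsum : ∑ k ∈ famSupport e' ρ, D.gen ℤ ℤ k 1 (fam e' D y ρ k) = 0 := by
    rw [← D.equiv_sum_smul_genClass (h₀ := h₀) (hker := hker) e' he' y ρ subset_rfl, hρ, map_zero]
  obtain ⟨T, b, b', hb, -, hj, hfam⟩ :=
    D.exists_rel_of_sum_gen_eq_zero ℤ ℤ (famSupport e' ρ) (fam e' D y ρ) (fun k hk => fam_eq_zero D y hk) hsum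
  -- coordinates `β k` of `j₋ (b k)` in the generators `c`, zero off `T`
  have hβ : ∀ k, ∃ β : Fin m → ℤ, (k ∉ T → β = 0) ∧ D.jMinus ℤ ℤ 1 (b k) = ∑ t, β t • c t := by
    intro k
    by_cases hk : k ∈ T
    · obtain ⟨β, hβ⟩ := hc (D.jMinus ℤ ℤ 1 (b k))
      exact ⟨β, fun hkT => (hkT hk).elim, hβ⟩
    · exact ⟨0, fun _ => rfl, by simp [hb k hk]⟩
  choose β hβT hβc using hβ
  -- `b k = ∑ β • b⁻`, `b' k = ∑ β • b⁺`
  have hbk : ∀ k, b k = ∑ t, β k t • bm t := fun k => hjmi (by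
    rw [hβc k, map_sum]
    exact Finset.sum_congr rfl fun t _ => by rw [map_zsmul, hbm])
  have hb'k : ∀ k, b' k = ∑ t, β k t • bp t := fun k => hjpi (by
    rw [← hj k, hβc k, map_sum]
    exact Finset.sum_congr rfl fun t _ => by rw [map_zsmul, hbp])
  -- the coefficients of `ρ`: `coeffAt ρ k = ∑ₜ (β k t • Bₜ − β (k−1) t • Aₜ)`
  have hcoef : ∀ k, coeffAt e' ρ k = ∑ t, (β k t • B t - β (k - 1) t • A t) := by
    intro k
    have h1 : comb y (coeffAt e' ρ k) = comb y (∑ t, (β k t • B t - β (k - 1) t • A t)) := by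
      change fam e' D y ρ k = _
      rw [hfam k, hbk k, hb'k (k - 1), map_sum, map_sum, map_sum]
      simp only [map_zsmul, hA, hB, map_sub, Finset.sum_sub_distrib]
    have h2 := hind (coeffAt e' ρ k - ∑ t, (β k t • B t - β (k - 1) t • A t)) (by rw [map_sub, h1, sub_self])
    exact sub_eq_zero.1 h2
  have hcoefl : ∀ k l, (ρ l).coeff (e'.symm (ofAdd k)) = ∑ t, (β k t * B t l - β (k - 1) t * A t l) := by
    intro k l
    have := congrFun (hcoef k) l
    rw [coeffAt] at this
    rw [this, Finset.sum_apply]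
    rfl
  -- `ρ = ∑ₜ λₜ • rowₜ` with `λₜ = ∑_{k ∈ T} β k t · e'⁻¹ k`
  have hρeq : ρ = ∑ t, (∑ k ∈ T, MonoidAlgebra.single (e'.symm (ofAdd k)) (β k t)) • relRow e' A B t := by
    funext l
    rw [Finset.sum_apply]
    apply MonoidAlgebra.ext
    apply Finsupp.ext
    intro a
    obtain ⟨k, rfl⟩ : ∃ k, e'.symm (ofAdd k) = a := ⟨toAdd (e' a), by simp⟩
    rw [hcoefl k l, MonoidAlgebra.coeff_sum, Finsupp.finsetSum_apply]
    refine Finset.sum_congr rfl fun t _ => ?_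
    rw [Pi.smul_apply, smul_eq_mul, relRow, mul_sub, Finset.sum_mul, Finset.sum_mul, MonoidAlgebra.coeff_sub,
      Finsupp.sub_apply, MonoidAlgebra.coeff_sum, MonoidAlgebra.coeff_sum, Finsupp.finsetSum_apply,
      Finsupp.finsetSum_apply]
    have e1 : (1 : Abelianization (FundamentalGroup X x₀)) = e'.symm (ofAdd 0) := by
      rw [ofAdd_zero, map_one]
    simp only [e1, coeff_single_symm_mul_single_symm, add_zero]
    simp only [show ∀ k' : ℤ, (k' + 1 = k) ↔ (k' = k - 1) from fun k' => by omega]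
    rw [Finset.sum_ite_eq' T k, Finset.sum_ite_eq' T (k - 1)]
    have hz : ∀ k', k' ∉ T → β k' t = 0 := fun k' hk' => by rw [hβT k' hk']; rfl
    by_cases hk : k ∈ T <;> by_cases hk' : k - 1 ∈ T <;> simp [hk, hk', hz]
  rw [hρeq]
  exact Submodule.sum_mem _ fun t _ => Submodule.smul_mem _ _ (Submodule.subset_span ⟨t, rfl⟩)

include he' in
/-- **The presentation of the Alexander module from a cut** (Rolfsen 1976, §8.C in homological
form; Lickorish 1997, Thm. 6.5). Let `D : CutData f` with `N₊`, `N₋` having injective augmentation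
(path connected or empty), `j₊ : H₁(N₊) → H₁(N)` bijective and `j₋` injective; let `y` be a
`ℤ`-basis of `H₁(Y; ℤ)` (in the sense of `comb y`), `c` generators of `H₁(N; ℤ)` realised on both
sides of the cut, `j₊ b⁺ₜ = cₜ = j₋ b⁻ₜ`, with push-offs `i₊ b⁺ₜ = ∑ₗ Aₜₗ yₗ`, `i₋ b⁻ₜ = ∑ₗ Bₜₗ yₗ`.
Then the Alexander module `G'/G''` of `G = π₁(X, x₀)` has the presentation
`ℤ[Gᵃᵇ]ⁿ → G'/G'' → 0` with kernel spanned by the `m` rows `(Bₜₗ − e'⁻¹(1) Aₜₗ)ₗ`.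
[cite: Rolfsen1976, §8.C] -/
theorem exists_presentation (hεp : Injective (singularHomology.ε ℤ ℤ ↥D.plus))
    (hεm : Injective (singularHomology.ε ℤ ℤ ↥D.minus)) (hjs : Surjective (D.jPlus ℤ ℤ 1))
    (hjpi : Injective (D.jPlus ℤ ℤ 1)) (hjmi : Injective (D.jMinus ℤ ℤ 1))
    (hspan : ∀ x : singularHomology ℤ ℤ ↥D.Y 1, ∃ u : Fin n → ℤ, x = comb y u)
    (hind : ∀ u : Fin n → ℤ, comb y u = 0 → u = 0)
    (hc : ∀ x : singularHomology ℤ ℤ ↥D.N 1, ∃ β : Fin m → ℤ, x = ∑ t, β t • c t)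
    (hbp : ∀ t, D.jPlus ℤ ℤ 1 (bp t) = c t) (hbm : ∀ t, D.jMinus ℤ ℤ 1 (bm t) = c t)
    (hA : ∀ t, D.iPlus ℤ ℤ 1 (bp t) = comb y (A t)) (hB : ∀ t, D.iMinus ℤ ℤ 1 (bm t) = comb y (B t)) :
    ∃ pres : (Fin n → Λ) →ₗ[Λ] alexanderModule (FundamentalGroup X x₀),
      (∀ v, pres v = ∑ l, v l • genClass h₀ hker D y l) ∧ Surjective pres ∧
      LinearMap.ker pres = Submodule.span Λ (Set.range (relRow e' A B)) := by
  refine ⟨Fintype.linearCombination Λ (genClass h₀ hker D y), fun v => rfl, ?_, ?_⟩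
  · rw [← LinearMap.range_eq_top, Fintype.range_linearCombination]
    exact D.span_genClass_eq_top e' he' y hεp hεm hjs hspan
  · apply le_antisymm
    · intro v hv
      rw [LinearMap.mem_ker, Fintype.linearCombination_apply] at hv
      exact D.mem_span_relRow_of_sum_smul_eq_zero e' he' y c bp bm A B hind hc hjpi hjmi hbp hbm hA hB v hv
    · rw [Submodule.span_le]
      rintro _ ⟨t, rfl⟩
      rw [SetLike.mem_coe, LinearMap.mem_ker, Fintype.linearCombination_apply]
      exact D.sum_relRow_smul_genClass e' he' y c bp bm A B hbp hbm hA hB t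

include he' in
/-- **The presentation, pushed to `ℤ[t, t⁻¹]`** (the shape consumed by
`Knot.exists_eq_mul_invert_of_seifert_presentation` and
`exists_isAlexanderPolynomial_of_square_presentation`): under the hypotheses of
`CutData.exists_presentation` there is a `ℤ[Gᵃᵇ]`-linear surjection `ℤ[Gᵃᵇ]ⁿ → G'/G''` whose kernel is
spanned by the rows of the `m × n` matrix `B − t A` over `ℤ[t, t⁻¹]`, pulled back along
`laurentEquivOfMulEquiv G e'` (`e' [g] = (f_* g)⁻¹`). For a knot complement cut along a Seifert
surface of genus `g` with the linking-dual basis (`m = n = 2g`, `B = V`, `A = Vᵀ`) this is the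
classical presentation matrix `V − tVᵀ` (Rolfsen 1976, §8.C; Lickorish 1997, Thm. 6.5).
[cite: Rolfsen1976, §8.C] -/
theorem exists_presentation_laurent (h₀ : winding f γ₀ = 1)
    (hker : (windingHom f x₀).ker = commutator (FundamentalGroup X x₀))
    (hεp : Injective (singularHomology.ε ℤ ℤ ↥D.plus))
    (hεm : Injective (singularHomology.ε ℤ ℤ ↥D.minus)) (hjs : Surjective (D.jPlus ℤ ℤ 1))
    (hjpi : Injective (D.jPlus ℤ ℤ 1)) (hjmi : Injective (D.jMinus ℤ ℤ 1))
    (hspan : ∀ x : singularHomology ℤ ℤ ↥D.Y 1, ∃ u : Fin n → ℤ, x = comb y u)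
    (hind : ∀ u : Fin n → ℤ, comb y u = 0 → u = 0)
    (hc : ∀ x : singularHomology ℤ ℤ ↥D.N 1, ∃ β : Fin m → ℤ, x = ∑ t, β t • c t)
    (hbp : ∀ t, D.jPlus ℤ ℤ 1 (bp t) = c t) (hbm : ∀ t, D.jMinus ℤ ℤ 1 (bm t) = c t)
    (hA : ∀ t, D.iPlus ℤ ℤ 1 (bp t) = comb y (A t)) (hB : ∀ t, D.iMinus ℤ ℤ 1 (bm t) = comb y (B t)) :
    ∃ pres : (Fin n → Λ) →ₗ[Λ] alexanderModule (FundamentalGroup X x₀), Surjective pres ∧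
      LinearMap.ker pres = Submodule.span Λ
        (Set.range ((B.map (LaurentPolynomial.C : ℤ →+* ℤ[T;T⁻¹]) -
          (LaurentPolynomial.T 1 : ℤ[T;T⁻¹]) • A.map (LaurentPolynomial.C : ℤ →+* ℤ[T;T⁻¹])).map
            (laurentEquivOfMulEquiv (FundamentalGroup X x₀) e').symm)) := by
  obtain ⟨pres, -, hπ, hkerπ⟩ := D.exists_presentation (h₀ := h₀) (hker := hker) e' he' y c bp bm A B hεp hεm hjs
    hjpi hjmi hspan hind hc hbp hbm hA hB
  refine ⟨pres, hπ, ?_⟩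
  rw [hkerπ]
  congr 2
  funext t l
  rw [Matrix.map_apply, eq_comm, RingEquiv.symm_apply_eq, relRow, map_sub, laurentEquivOfMulEquiv_single,
    laurentEquivOfMulEquiv_single, map_one, toAdd_one, LaurentPolynomial.T_zero, mul_one,
    MulEquiv.apply_symm_apply, toAdd_ofAdd, Matrix.sub_apply, Matrix.smul_apply, Matrix.map_apply,
    Matrix.map_apply, smul_eq_mul, mul_comm]

end Presentation

end CutData

end CyclicCover

end CircleMaps

end Literature.Topology.FourManifolds
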